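import Summits.QuantumAdvantage.QuantumAdvantage.Theorems.CubicForrelationNearExactIsExactEighteenPairing

/-!
# Crux `CubicForrelation.NearExactIsExact` (stmt-QuantumAdvantage-14043) — n = 18, TWO-SIDED: at level 7 (`W_g ∈ 128ℤ`, some `W_g/128` odd)
  the boundary value `Φ = 63/64` is not realizable

Certificate seat `b2b-cforr-cert` (gen 6).  HONEST FRAMING: a theorem about cubic Boolean pairs on 18 bits (finite slice `n = 18` of the crux) —
the level-7 boundary configuration of the certified bound `θ₁₈ ≤ 63/64` is excluded two-sidedly; NOT summit progress.

`el7_levelSeven_false`: for cubic `f, g : 𝔽₂¹⁸ → 𝔽₂` with `W_g = 128·u'`, some `u'(x)` odd, and `Φ(f,g) ≥ 63/64`: contradiction.  Proof: the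
parity `p = [u' odd]` is AFFINE (tower); if `p ≡ 1` every point costs `≥ 4` in the budget `Σ(u − 8s)² = 4Σ(u' − 4s)² = 2²⁵(1−Φ) ≤ 2¹⁹`
(`u = 2u'`), too much; so `p` is balanced, `P = {u' odd}` is an affine HYPERPLANE `x₁ ⊕ V₀` (`2¹⁷` points, `mw_flat_of_minweight`) carrying
the whole budget: `u' = 4s` off `P` and `e := u' − 4s = ±1` on `P`, `Φ = 63/64`.  With ONE direction `t ∉ V₀` the general 4- and 5-flat sums
(`fs_flat_sum_dvd` at `n = 18`: `8 ∣ Σ₄ u`, `16 ∣ Σ₅ u`; Ax `8Σ(−1)^f ∈ 32ℤ`) localise to `P` (the translate by `t` carries `u − 8s = 0`) and give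
(H3)/(H4) for `e`; the engine `fl1_flat_l1` yields `Σ|(e1_P)^| ≤ 2¹⁹`, while the pairing needs `Σ_y (−1)^g (2e1_P)^(y) = 2²⁴` (`ep_pairing18`).

References: J. Ax (1964) / R. J. McEliece (1972); MacWilliams–Sloane (1977) Ch. 13–15; R. O'Donnell (2014) §3.3.  Everything below is proved
from Mathlib and the tree; axioms are the standard three.
-/

set_option linter.dupNamespace false -- D-0017: single-problem summit ⇒ `QuantumAdvantage.QuantumAdvantage` by design

noncomputable section

namespace Summit.QuantumAdvantage.QuantumAdvantage.Theorems.CubicForrelation.NearExactIsExact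

open Finset
open Literature.Computability.QuantumComplexity
open Literature.Computability.QuantumComplexity.BuzetChailloux (bxor zeroVec bxor_bxor_cancel_left bxor_zeroVec zeroVec_bxor bxor_comm
  bxor_self)
open Literature.Computability.QuantumComplexity.DerivativeWalsh (W)

/-- **Level 7 at the boundary on 18 bits is empty.**  For cubic `f, g : 𝔽₂¹⁸ → 𝔽₂` with `W_g = 128·u'`, some `u'(x)` odd and
`Φ(f,g) ≥ 63/64`: contradiction.  Finite-slice statement; NOT summit progress. [this work] -/
theorem el7_levelSeven_false (f g : (Fin (9 + 9) → Bool) → Bool) (hf : IsDegLeFun 3 f) (hg : IsDegLeFun 3 g)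
    (u' : (Fin (9 + 9) → Bool) → ℤ) (hu' : ∀ x, W (fun y => signOf (g y)) x = (2 : ℝ) ^ 7 * (u' x : ℝ))
    (hodd : ∃ x, Odd (u' x)) (hΦ : (63 / 64 : ℝ) ≤ forrelation f g) : False := by
  classical
  obtain ⟨x₁, hx₁⟩ := hodd
  -- `u = 2u'` at the Ax level `6`
  set u : (Fin (9 + 9) → Bool) → ℤ := fun x => 2 * u' x with hudef
  have hu : ∀ x, W (fun y => signOf (g y)) x = (2 : ℝ) ^ 6 * (u x : ℝ) := by
    intro x; rw [hu' x]; simp only [u]; push_cast; ring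
  -- the parity of `u'` is affine
  have hp : IsDegLeFun 1 (fun x => decide (Odd (u' x))) :=
    stub_walshTower stub_axParity (9 + 9) 7 1 g u' hg hu' (by intro k hk hkn; omega)
  have hp' : IsDegLeFun (0 + 1) (fun x => decide (Odd (u' x))) := hp
  -- budget `Σ (u' − 4s)² ≤ 2¹⁷`
  have hbud := ep_budget18 f g u hu
  have hB : (∑ x, (u' x - 4 * sZ (f x)) ^ 2 : ℤ) ≤ 2 ^ 17 := by
    have h4 : ∀ x, (u x - 8 * sZ (f x)) ^ 2 = 4 * (u' x - 4 * sZ (f x)) ^ 2 := fun x => by simp only [u]; ring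
    have h' : ((∑ x, (u x - 8 * sZ (f x)) ^ 2 : ℤ) : ℝ) ≤ 2 ^ 19 := by rw [hbud]; nlinarith
    have h'' : (∑ x, (u x - 8 * sZ (f x)) ^ 2 : ℤ) ≤ 2 ^ 19 := by exact_mod_cast h'
    rw [sum_congr rfl fun x _ => h4 x, ← mul_sum] at h''
    linarith
  -- odd points cost `≥ 1`: `#P ≤ 2¹⁷`, so the affine parity is not identically `1`, hence balanced: `#P = 2¹⁷`
  set P := univ.filter (fun x : Fin (9 + 9) → Bool => Odd (u' x)) with hPdef
  have hmemP : ∀ x, x ∈ P ↔ Odd (u' x) := fun x => by simp [hPdef]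
  have hfilt : (univ.filter fun x : Fin (9 + 9) → Bool => decide (Odd (u' x)) = true) = P := filter_congr fun x _ => by simp
  have hsumP : (∑ x, (if Odd (u' x) then 1 else 0 : ℤ)) = #P := by rw [sum_boole]
  have hnonneg : ∀ x, 0 ≤ (u' x - 4 * sZ (f x)) ^ 2 - (if Odd (u' x) then 1 else 0 : ℤ) := by
    intro x
    by_cases h : Odd (u' x)
    · rw [if_pos h]; have := ft_sq_ge_one (tp_sZ_cases (f x)) h; linarith
    · rw [if_neg h]; have := sq_nonneg (u' x - 4 * sZ (f x)); linarith
  have hPle : (#P : ℤ) ≤ 2 ^ 17 := by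
    rw [← hsumP]
    exact le_trans (sum_le_sum fun x _ => by have := hnonneg x; linarith) hB
  -- `P` has exactly `2¹⁷` points: Ax with `d = 1` on the full cube gives `2·#P = 2¹⁸ − 2¹⁷ z`
  have hPcard : #P = 2 ^ 17 := by
    obtain ⟨z, hz⟩ := td_count_cube (le_refl 1) (fun x => decide (Odd (u' x))) hp univ
    rw [card_univ, Fintype.card_fin, show (9 + 9 + 1 - 1) / 1 = 18 by norm_num] at hz
    have hset : ({x : Fin (9 + 9) → Bool | (∀ i, x i = true → i ∈ (univ : Finset (Fin (9 + 9)))) ∧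
        decide (Odd (u' x)) = true} : Finset _) = P := by
      ext x; simp [hPdef]
    rw [hset] at hz
    have hPpos : (0 : ℤ) < #P := by
      have : 0 < #P := card_pos.2 ⟨x₁, (hmemP x₁).2 hx₁⟩
      exact_mod_cast this
    norm_num at hz
    -- `hz : 2·#P = 2¹⁸ − 2¹⁸·z`; `0 < #P ≤ 2¹⁷` forces `z = 0`
    have hz0 : z = 0 := by
      rcases lt_trichotomy z 0 with h | h | h
      · nlinarith
      · exact h
      · nlinarith
    rw [hz0] at hz
    have : (#P : ℤ) = 2 ^ 17 := by linarith
    exact_mod_cast this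
  -- everything is tight
  have hsum0 : ∑ x, ((u' x - 4 * sZ (f x)) ^ 2 - (if Odd (u' x) then 1 else 0 : ℤ)) = 0 := by
    refine le_antisymm ?_ (sum_nonneg fun x _ => hnonneg x)
    rw [sum_sub_distrib, hsumP, hPcard]
    push_cast
    linarith
  have hzero' : ∀ x, (u' x - 4 * sZ (f x)) ^ 2 - (if Odd (u' x) then 1 else 0 : ℤ) = 0 :=
    fun x => (sum_eq_zero_iff_of_nonneg fun y _ => hnonneg y).1 hsum0 x (mem_univ x)
  have hoff : ∀ x, ¬ Odd (u' x) → u' x - 4 * sZ (f x) = 0 := by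
    intro x hx
    have h := hzero' x
    rw [if_neg hx, sub_zero] at h
    exact (pow_eq_zero_iff two_ne_zero).1 h
  have hon : ∀ x, Odd (u' x) → u' x - 4 * sZ (f x) = 1 ∨ u' x - 4 * sZ (f x) = -1 := by
    intro x hx
    have h := hzero' x
    rw [if_pos hx] at h
    have h1 : (u' x - 4 * sZ (f x)) * (u' x - 4 * sZ (f x)) = 1 := by rw [← pow_two]; linarith
    exact mul_self_eq_one_iff.1 h1
  have hΦeq : forrelation f g = 63 / 64 := by
    have hT : (∑ x, (u x - 8 * sZ (f x)) ^ 2 : ℤ) = 2 ^ 19 := by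
      have h4 : ∀ x, (u x - 8 * sZ (f x)) ^ 2 = 4 * ((u' x - 4 * sZ (f x)) ^ 2 - (if Odd (u' x) then 1 else 0 : ℤ)) +
          4 * (if Odd (u' x) then 1 else 0 : ℤ) := fun x => by simp only [u]; ring
      rw [sum_congr rfl fun x _ => h4 x, sum_add_distrib, ← mul_sum, ← mul_sum, hsum0, hsumP, hPcard]
      norm_num
    have h : ((∑ x, (u x - 8 * sZ (f x)) ^ 2 : ℤ) : ℝ) = 2 ^ 19 := by exact_mod_cast hT
    rw [hbud] at h
    linarith
  -- `P` is a hyperplane `x₁ ⊕ V₀`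
  have hmw := mw_flat_of_minweight 0 (fun x => decide (Odd (u' x))) hp' (by rw [hfilt, hPcard]; norm_num)
  rw [hfilt] at hmw
  obtain ⟨h0, hadd, hcardV, hcoset⟩ := hmw
  set V₀ := univ.filter (fun a : Fin (9 + 9) → Bool => ∀ x, decide (Odd (u' (bxor x a))) = decide (Odd (u' x))) with hV₀
  have hS : P = V₀.image (bxor x₁) := hcoset x₁ (by simpa using hx₁)
  rw [hPcard] at hcardV
  -- one transversal direction
  obtain ⟨t, -, ht⟩ := fl1_avoid univ V₀ [zeroVec] (by
    rw [List.length_singleton, hcardV, card_univ, Fintype.card_fun, Fintype.card_bool, Fintype.card_fin]; norm_num)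
  have htV : t ∉ V₀ := by simpa only [zeroVec_bxor] using ht zeroVec (by simp)
  -- the sign pattern and the vanishing of the residual off `P`
  set e : (Fin (9 + 9) → Bool) → ℤ := fun x => u' x - 4 * sZ (f x) with hedef
  have he : ∀ x ∈ P, e x = 1 ∨ e x = -1 := fun x hx => hon x ((hmemP x).1 hx)
  have hF0 : ∀ y, y ∉ P → u y - 8 * sZ (f y) = 0 := by
    intro y hy
    have := hoff y (fun h => hy ((hmemP y).2 h))
    simp only [u]; linarith
  have hFe : ∀ y, u y - 8 * sZ (f y) = 2 * e y := fun y => by simp only [u, e]; ring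
  have hPV : ∀ x, x ∈ P → ∀ a ∈ V₀, bxor x a ∈ P := fun x hx a ha => fl1_coset_vadd hadd hS hx ha
  -- localisation by the single direction `t`
  have hloc : ∀ {k : ℕ} (x : Fin (9 + 9) → Bool) (a : Fin k → Fin (9 + 9) → Bool),
      (∀ ε : Fin k → Bool, (fun j => x j ^^ decide (Odd #(univ.filter fun i => ε i && a i j))) ∈ P) →
      ∑ ε : Fin (k + 1) → Bool, (u (fun j => x j ^^ decide (Odd #(univ.filter fun i =>
          ε i && (Matrix.vecCons t a : Fin (k + 1) → Fin (9 + 9) → Bool) i j))) -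
        8 * sZ (f (fun j => x j ^^ decide (Odd #(univ.filter fun i =>
          ε i && (Matrix.vecCons t a : Fin (k + 1) → Fin (9 + 9) → Bool) i j))))) =
      ∑ ε : Fin k → Bool, 2 * e (fun j => x j ^^ decide (Odd #(univ.filter fun i => ε i && a i j))) := by
    intro k x a hin
    have p1 := fr_sum_peel (fun y => u y - 8 * sZ (f y)) x t a
    beta_reduce at p1
    rw [p1, sum_eq_zero fun ε _ => hF0 _ (fl1_coset_out h0 hadd hS (hin ε) htV), add_zero]
    exact sum_congr rfl fun ε _ => hFe _
  -- (H3) and (H4)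
  have H3 : ∀ x ∈ P, ∀ a b c : Fin (9 + 9) → Bool, a ∈ V₀ → b ∈ V₀ → c ∈ V₀ →
      (4 : ℤ) ∣ ∑ ε : Fin 3 → Bool, e (fun j => x j ^^ decide (Odd #(univ.filter fun i =>
        ε i && (![a, b, c] : Fin 3 → Fin (9 + 9) → Bool) i j))) := by
    intro x hx a b c ha hb hc
    have hin : ∀ ε : Fin 3 → Bool, (fun j => x j ^^ decide (Odd #(univ.filter fun i =>
        ε i && (![a, b, c] : Fin 3 → Fin (9 + 9) → Bool) i j))) ∈ P :=
      fun ε => fr_mem_flatPt3 V₀ h0 (· ∈ P) hPV hx ![a, b, c] (fun i => by fin_cases i <;> assumption) ε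
    have h8 := fs_flat_sum_dvd (e := 3) g u hg hu x ![t, a, b, c] (by norm_num)
    obtain ⟨zf, hzf⟩ := sl_sum_sZ_flat f hf x ![t, a, b, c]
    have hzf' : ∑ ε : Fin 4 → Bool, 8 * sZ (f (fun j => x j ^^ decide (Odd #(univ.filter fun i =>
          ε i && (![t, a, b, c] : Fin 4 → Fin (9 + 9) → Bool) i j)))) = 8 * (4 * zf) := by
      rw [← mul_sum, hzf]; norm_num
    have h8n : (8 : ℤ) ∣ ∑ ε : Fin 4 → Bool, u (fun j => x j ^^ decide (Odd #(univ.filter fun i =>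
          ε i && (![t, a, b, c] : Fin 4 → Fin (9 + 9) → Bool) i j))) := by
      have e8 : (2 : ℤ) ^ 3 = 8 := by norm_num
      rw [e8] at h8; exact h8
    have h8' : (8 : ℤ) ∣ ∑ ε : Fin 4 → Bool, (u (fun j => x j ^^ decide (Odd #(univ.filter fun i =>
          ε i && (![t, a, b, c] : Fin 4 → Fin (9 + 9) → Bool) i j))) -
        8 * sZ (f (fun j => x j ^^ decide (Odd #(univ.filter fun i =>
          ε i && (![t, a, b, c] : Fin 4 → Fin (9 + 9) → Bool) i j))))) := by
      rw [sum_sub_distrib, hzf']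
      exact dvd_sub h8n (Dvd.intro _ rfl)
    rw [hloc x ![a, b, c] hin, ← mul_sum] at h8'
    obtain ⟨k8, hk8⟩ := h8'
    exact ⟨k8, by linarith⟩
  have H4 : ∀ x ∈ P, ∀ a₀ a₁ a₂ a₃ : Fin (9 + 9) → Bool, a₀ ∈ V₀ → a₁ ∈ V₀ → a₂ ∈ V₀ → a₃ ∈ V₀ →
      (8 : ℤ) ∣ ∑ ε : Fin 4 → Bool, e (fun j => x j ^^ decide (Odd #(univ.filter fun i =>
        ε i && (![a₀, a₁, a₂, a₃] : Fin 4 → Fin (9 + 9) → Bool) i j))) := by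
    intro x hx a₀ a₁ a₂ a₃ ha₀ ha₁ ha₂ ha₃
    have hin : ∀ ε : Fin 4 → Bool, (fun j => x j ^^ decide (Odd #(univ.filter fun i =>
        ε i && (![a₀, a₁, a₂, a₃] : Fin 4 → Fin (9 + 9) → Bool) i j))) ∈ P :=
      fun ε => fr_mem_flatPt4 V₀ h0 (· ∈ P) hPV hx ![a₀, a₁, a₂, a₃] (fun i => by fin_cases i <;> assumption) ε
    have h16 := fs_flat_sum_dvd (e := 4) g u hg hu x ![t, a₀, a₁, a₂, a₃] (by norm_num)
    obtain ⟨zf, hzf⟩ := sl_sum_sZ_flat f hf x ![t, a₀, a₁, a₂, a₃]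
    have hzf' : ∑ ε : Fin 5 → Bool, 8 * sZ (f (fun j => x j ^^ decide (Odd #(univ.filter fun i =>
          ε i && (![t, a₀, a₁, a₂, a₃] : Fin 5 → Fin (9 + 9) → Bool) i j)))) = 16 * (2 * zf) := by
      rw [← mul_sum, hzf]; norm_num; ring
    have h16n : (16 : ℤ) ∣ ∑ ε : Fin 5 → Bool, u (fun j => x j ^^ decide (Odd #(univ.filter fun i =>
          ε i && (![t, a₀, a₁, a₂, a₃] : Fin 5 → Fin (9 + 9) → Bool) i j))) := by
      have e16 : (2 : ℤ) ^ 4 = 16 := by norm_num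
      rw [e16] at h16; exact h16
    have h16' : (16 : ℤ) ∣ ∑ ε : Fin 5 → Bool, (u (fun j => x j ^^ decide (Odd #(univ.filter fun i =>
          ε i && (![t, a₀, a₁, a₂, a₃] : Fin 5 → Fin (9 + 9) → Bool) i j))) -
        8 * sZ (f (fun j => x j ^^ decide (Odd #(univ.filter fun i =>
          ε i && (![t, a₀, a₁, a₂, a₃] : Fin 5 → Fin (9 + 9) → Bool) i j))))) := by
      rw [sum_sub_distrib, hzf']
      exact dvd_sub h16n (Dvd.intro _ rfl)
    rw [hloc x ![a₀, a₁, a₂, a₃] hin, ← mul_sum] at h16'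
    obtain ⟨k16, hk16⟩ := h16'
    exact ⟨k16, by linarith⟩
  -- the engine and the pairing
  have hE := fl1_flat_l1 V₀ P x₁ h0 hadd hS e he H3 H4
  set A : (Fin (9 + 9) → Bool) → ℝ := fun x => if x ∈ P then (e x : ℝ) else 0 with hA
  have hAτ : (fun x => (u x : ℝ) - 8 * signOf (f x)) = fun x => 2 * A x := by
    funext x
    have h2 : (u x : ℝ) - 8 * signOf (f x) = (((u x - 8 * sZ (f x) : ℤ)) : ℝ) := by push_cast; rw [tp_sZ_cast]
    rw [h2]
    by_cases hx : x ∈ P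
    · simp only [A, if_pos hx]; rw [hFe x]; push_cast; ring
    · simp only [A, if_neg hx]; rw [hF0 x hx]; norm_num
  have hpair := ep_pairing18 f g u hu
  rw [hΦeq, hAτ] at hpair
  have hpair' : ∑ y, signOf (g y) * W A y = 2 ^ 23 := by
    have e2 : ∀ y, signOf (g y) * W (fun x => 2 * A x) y = 2 * (signOf (g y) * W A y) := fun y => by
      rw [fl1_W_smul]; ring
    have h30 : (2 : ℝ) ^ 30 * (1 - 63 / 64) = 2 * 2 ^ 23 := by norm_num
    rw [sum_congr rfl fun y _ => e2 y, ← mul_sum, h30] at hpair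
    linarith
  have hge : (2 : ℝ) ^ 23 ≤ ∑ y, |W A y| := by rw [← hpair']; exact fl1_pairing_le_l1 g (W A)
  have hsq : ((2 : ℝ) ^ 23) ^ 2 ≤ (∑ y, |W A y|) ^ 2 := pow_le_pow_left₀ (by positivity) hge 2
  norm_num at hE hsq
  linarith

end Summit.QuantumAdvantage.QuantumAdvantage.Theorems.CubicForrelation.NearExactIsExact

end
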